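import Summits.AtomisticToContinuum.HydrodynamicLimit.Theorems.CollisionIsometryCLTAdaptedWeightCLTBHDVTransfer
import Summits.AtomisticToContinuum.HydrodynamicLimit.Theorems.CollisionIsometryCLTAdaptedWeightCLTBHEntropyBudgetWeights

/-!
# Aggregate DV step (stub `stub_dvAggregate`, G2) for the line `block-h-dissipation-closure`
# (crux `AdaptedWeightCLT`, stmt-AtomisticToContinuum-14868), file 1: joint measurability in (location, quadruple)

Support file (`--supports stmt-AtomisticToContinuum-14868`, anchor `bhDVAggregate_measurable_anchor`) of the line
lead `prover-line-stmt-AtomisticToContinuum-14868-c4-0`, written for the registered stub `stub_dvAggregate`.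
The S2 worker reduced G2 (`DVAggregateOn`) to the integrability ON `𝕋³` of the three parametric integrals
`x ↦ cellOK · crossE`, `x ↦ klTerm`, `x ↦ cellOK · dvAct` (`DVTransfer.dvAggregateOn_of_xIntegrable`). This file
supplies the measurability half, for a continuous kernel `ψ_N`:

* `continuous_pairZ`, `measurable_cellOK`, `continuous_contactMass`, `continuous_contactDens_uncurry` (the smeared
  contact density is jointly continuous in `(x, y)`: a finite sum over the contacts of the window);
* `measurable_pairSmear` (the smeared pair term `y ↦ ∫ B(ω) G_h^{⊗4}(c(ω), y) dω` is Borel: Fubini measurability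
  of a jointly continuous integrand over the compact fibre), `measurable_chaosDens_uncurry`,
  `measurable_dLam_uncurry` (from S1's `EntropyBudget.measurable_cellLaw_uncurry`);
* the three integrands of `dvAct`, `klTerm`, `crossE` are jointly Borel on `𝕋³ × Quad`
  (`measurable_dvActIntegrand`, `measurable_klIntegrand`, `measurable_tiltIntegrand`);
* `integrable_parametric` — a jointly Borel `F : 𝕋³ × Quad → ℝ` dominated by an integrable function of `y`
  alone has `x ↦ ∫ F(x, y) dy` integrable on `𝕋³` (finite Haar measure; `Integrable.comp_snd`, Fubini).

No definitions.
-/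

namespace Summit.AtomisticToContinuum.HydrodynamicLimit.Theorems.BlockHDissipation

open scoped BigOperators Topology Classical MeasureTheory ENNReal InnerProductSpace
open Filter Set MeasureTheory Real
open Literature.Analysis.FluidPDE
open Summit.AtomisticToContinuum.HydrodynamicLimit.Theorems.ContactSourceDuhamel (T3 V3 Cfg Vel Flow Flows)
open Literature.MathematicalPhysics.KineticTheory (hsDiameter collide hardSphereKernel sphereMeasure)

noncomputable section

namespace DVAggregate

variable {σ : ℝ} {N : ℕ} {ψ : ℕ → T3 → ℝ}

/-! ## Objects depending on the location only -/

/-- The pair flux of the atomic cell law is continuous in the location. -/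
theorem continuous_pairZ (hψc : Continuous (ψ N)) (w : Cfg N) : Continuous fun x => pairZ N ψ w x := by
  unfold pairZ
  refine continuous_finsetSum _ fun l _ => continuous_finsetSum _ fun l' _ => ?_
  exact ((EntropyBudget.continuous_cw w hψc l).mul (EntropyBudget.continuous_cw w hψc l')).mul continuous_const

/-- The non-junk indicator `cellOK` is Borel in the location. -/
theorem measurable_cellOK (hψc : Continuous (ψ N)) (Φ : Flow σ N) (γc : ℝ) (z : Cfg N) (k : ℕ) :
    Measurable fun x => cellOK σ N Φ ψ γc z k x := by
  unfold cellOK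
  refine Measurable.ite ?_ measurable_const measurable_const
  exact measurableSet_lt measurable_const (continuous_pairZ hψc _).measurable

/-- `0 ≤ cellOK ≤ 1`, as a norm bound. -/
theorem norm_cellOK_le (Φ : Flow σ N) (ψ : ℕ → T3 → ℝ) (γc : ℝ) (z : Cfg N) (k : ℕ) (x : T3) :
    ‖cellOK σ N Φ ψ γc z k x‖ ≤ 1 := by
  unfold cellOK
  split_ifs <;> simp

/-- The contact mass is continuous in the location (finitely many collisions in the window). -/
theorem continuous_contactMass (hψc : Continuous (ψ N)) (Φ : Flow σ N) (γc t : ℝ) (z : Cfg N) (k : ℕ)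
    (hfin : (collisionTimes (Torus.geometry (Fin 3)) (hsDiameter σ N) (fun s => Φ.flow s z) ∩ win γc N t k).Finite) :
    Continuous fun x => contactMass σ N Φ ψ γc t z k x := by
  have e : (fun x => contactMass σ N Φ ψ γc t z k x) = fun x => ∑ s ∈ hfin.toFinset,
      ∑ p ∈ contactPairs (Torus.geometry (Fin 3)) (hsDiameter σ N) (Φ.flow s z), cw N ψ (Φ.flow s z) x p.1 :=
    funext fun x => DVTransfer.contactMass_eq_sum Φ ψ γc t z k x hfin
  rw [e]
  exact continuous_finsetSum _ fun s _ => continuous_finsetSum _ fun p _ =>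
    EntropyBudget.continuous_cw _ hψc _

/-- The contact mass is bounded uniformly in the location by the kernel bound times the number of charged
contacts of the window. -/
theorem contactMass_le (Φ : Flow σ N) {A : ℝ} (hA : ∀ y, ψ N y ≤ A) (γc t : ℝ) (z : Cfg N) (k : ℕ)
    (hfin : (collisionTimes (Torus.geometry (Fin 3)) (hsDiameter σ N) (fun s => Φ.flow s z) ∩ win γc N t k).Finite)
    (x : T3) :
    contactMass σ N Φ ψ γc t z k x ≤ ∑ s ∈ hfin.toFinset,
      ∑ _p ∈ contactPairs (Torus.geometry (Fin 3)) (hsDiameter σ N) (Φ.flow s z), A := by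
  rw [DVTransfer.contactMass_eq_sum Φ ψ γc t z k x hfin]
  exact Finset.sum_le_sum fun s _ => Finset.sum_le_sum fun p _ => hA _

/-! ## Joint measurability in (location, quadruple) -/

/-- The smeared contact density is jointly continuous in `(x, y)` (finitely many collisions in the window). -/
theorem continuous_contactDens_uncurry (hψc : Continuous (ψ N)) (Φ : Flow σ N) (γc h t : ℝ) (z : Cfg N) (k : ℕ)
    (hfin : (collisionTimes (Torus.geometry (Fin 3)) (hsDiameter σ N) (fun s => Φ.flow s z) ∩ win γc N t k).Finite) :
    Continuous fun p : T3 × Quad => contactDens σ N Φ ψ γc h t z k p.1 p.2 := by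
  have e : (fun p : T3 × Quad => contactDens σ N Φ ψ γc h t z k p.1 p.2) = fun p => ∑ s ∈ hfin.toFinset,
      ∑ pp ∈ contactPairs (Torus.geometry (Fin 3)) (hsDiameter σ N) (Φ.flow s z),
        cw N ψ (Φ.flow s z) p.1 pp.1 * gauss4 h (quadOf N (Φ.flow s z) pp.1 pp.2) p.2 :=
    funext fun p => DVTransfer.contactDens_eq_sum Φ ψ γc h t z k p.1 hfin p.2
  rw [e]
  refine continuous_finsetSum _ fun s _ => continuous_finsetSum _ fun pp _ => ?_
  exact ((EntropyBudget.continuous_cw _ hψc _).comp continuous_fst).mul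
    ((DVTransfer.continuous_gauss4 h _).comp continuous_snd)

/-- The smeared pair term `y ↦ ∫ B(ω) G_h^{⊗4}((v, w, v′, w′), y) dω` is Borel on `Quad` (Fubini measurability of
the jointly continuous integrand over the finite fibre measure). -/
theorem measurable_pairSmear (h : ℝ) (p : V3 × V3) : Measurable fun y : Quad =>
    ∫ ω, hardSphereKernel p ω * gauss4 h (p.1, p.2, (collide ω p).1, (collide ω p).2) y ∂sphereMeasure := by
  haveI := isFiniteMeasure_sphereMeasure (E := V3)
  have hsm : StronglyMeasurable (fun q : Metric.sphere (0 : V3) 1 × Quad =>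
      hardSphereKernel p q.1 * gauss4 h (p.1, p.2, (collide q.1 p).1, (collide q.1 p).2) q.2) :=
    (DVTransfer.continuous_pairSmearIntegrand h p).measurable.stronglyMeasurable
  exact (hsm.integral_prod_left' (μ := (sphereMeasure : Measure (Metric.sphere (0 : V3) 1)))).measurable

/-- The chaos reference is jointly Borel in `(x, y)`. -/
theorem measurable_chaosDens_uncurry (hψc : Continuous (ψ N)) (h : ℝ) (w : Cfg N) :
    Measurable fun p : T3 × Quad => chaosDens N ψ h w p.1 p.2 := by
  unfold chaosDens
  refine (((continuous_pairZ hψc w).measurable.comp measurable_fst).inv).mul ?_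
  refine Finset.measurable_sum _ fun l _ => Finset.measurable_sum _ fun l' _ => ?_
  exact (((EntropyBudget.continuous_cw w hψc l).mul (EntropyBudget.continuous_cw w hψc l')).measurable.comp
    measurable_fst).mul ((measurable_pairSmear h ((w l).2, (w l').2)).comp measurable_snd)

/-- `(x, y) ↦ log f̂_x(π(x, y))` is jointly Borel for a Borel selection `π` of a velocity (from S1's
`EntropyBudget.measurable_cellLaw_uncurry`; the composition is rewritten through `Function.comp_def`). -/
theorem measurable_log_cellLaw_comp (hψc : Continuous (ψ N)) (h δ : ℝ) (w : Cfg N) {pr : T3 × Quad → V3}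
    (hpr : Measurable pr) : Measurable fun p : T3 × Quad => Real.log (cellLaw N ψ h δ w p.1 (pr p)) := by
  have hcl : Measurable fun p : T3 × V3 => cellLaw N ψ h δ w p.1 p.2 :=
    EntropyBudget.measurable_cellLaw_uncurry w hψc
  have h3 := Real.measurable_log.comp (hcl.comp (measurable_fst.prodMk hpr))
  simpa only [Function.comp_def] using h3

/-- The log-increment `ΔΛ` is jointly Borel in `(x, y)`. -/
theorem measurable_dLam_uncurry (hψc : Continuous (ψ N)) (h δ : ℝ) (w : Cfg N) :
    Measurable fun p : T3 × Quad => dLam N ψ h δ w p.1 p.2 := by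
  have h1 : Measurable fun p : T3 × Quad => Real.log (cellLaw N ψ h δ w p.1 p.2.1) :=
    measurable_log_cellLaw_comp hψc h δ w (pr := fun p => p.2.1) measurable_snd.fst
  have h2 : Measurable fun p : T3 × Quad => Real.log (cellLaw N ψ h δ w p.1 p.2.2.1) :=
    measurable_log_cellLaw_comp hψc h δ w (pr := fun p => p.2.2.1) measurable_snd.snd.fst
  have h3 : Measurable fun p : T3 × Quad => Real.log (cellLaw N ψ h δ w p.1 p.2.2.2.1) :=
    measurable_log_cellLaw_comp hψc h δ w (pr := fun p => p.2.2.2.1) measurable_snd.snd.snd.fst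
  have h4 : Measurable fun p : T3 × Quad => Real.log (cellLaw N ψ h δ w p.1 p.2.2.2.2) :=
    measurable_log_cellLaw_comp hψc h δ w (pr := fun p => p.2.2.2.2) measurable_snd.snd.snd.snd
  have h5 : Measurable fun p : T3 × Quad => Real.log (cellLaw N ψ h δ w p.1 p.2.2.2.1) +
      Real.log (cellLaw N ψ h δ w p.1 p.2.2.2.2) - Real.log (cellLaw N ψ h δ w p.1 p.2.1) -
      Real.log (cellLaw N ψ h δ w p.1 p.2.2.1) := ((h3.add h4).sub h1).sub h2
  unfold dLam
  exact h5

/-- The integrand of `dvAct` is jointly Borel. -/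
theorem measurable_dvActIntegrand (hψc : Continuous (ψ N)) (Φ : Flow σ N) (γc h δ t : ℝ) (z : Cfg N) (k : ℕ)
    (hfin : (collisionTimes (Torus.geometry (Fin 3)) (hsDiameter σ N) (fun s => Φ.flow s z) ∩ win γc N t k).Finite)
    (w : Cfg N) :
    Measurable fun p : T3 × Quad => 2⁻¹ * dLam N ψ h δ w p.1 p.2 * contactDens σ N Φ ψ γc h t z k p.1 p.2 :=
  (measurable_const.mul (measurable_dLam_uncurry hψc h δ w)).mul
    (continuous_contactDens_uncurry hψc Φ γc h t z k hfin).measurable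

/-- The integrand of `klTerm` is jointly Borel. -/
theorem measurable_klIntegrand (hψc : Continuous (ψ N)) (Φ : Flow σ N) (γc h t : ℝ) (z : Cfg N) (k : ℕ)
    (hfin : (collisionTimes (Torus.geometry (Fin 3)) (hsDiameter σ N) (fun s => Φ.flow s z) ∩ win γc N t k).Finite)
    (w : Cfg N) :
    Measurable fun p : T3 × Quad => contactDens σ N Φ ψ γc h t z k p.1 p.2 *
      Real.log (contactDens σ N Φ ψ γc h t z k p.1 p.2 / (contactMass σ N Φ ψ γc t z k p.1 * chaosDens N ψ h w p.1 p.2)) := by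
  have hp := (continuous_contactDens_uncurry hψc Φ γc h t z k hfin).measurable
  refine hp.mul (Real.measurable_log.comp (hp.div ?_))
  exact ((continuous_contactMass hψc Φ γc t z k hfin).measurable.comp measurable_fst).mul
    (measurable_chaosDens_uncurry hψc h w)

/-- The integrand of the smeared cross-Hellinger mass (`crossE`) is jointly Borel. -/
theorem measurable_tiltIntegrand (hψc : Continuous (ψ N)) (h δ : ℝ) (w : Cfg N) :
    Measurable fun p : T3 × Quad => Real.exp (2⁻¹ * dLam N ψ h δ w p.1 p.2) * chaosDens N ψ h w p.1 p.2 :=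
  (Real.measurable_exp.comp (measurable_const.mul (measurable_dLam_uncurry hψc h δ w))).mul
    (measurable_chaosDens_uncurry hψc h w)

/-! ## Parametric integrals over `Quad` as functions on the torus -/

/-- **Dominated parametric integrals are integrable on the torus.** A jointly Borel `F : 𝕋³ × Quad → ℝ` with
`‖F(x, y)‖ ≤ g(y)` for an integrable `g` has `x ↦ ∫ F(x, y) dy` integrable on `𝕋³` (the Haar measure of `𝕋³` is
finite, so `(x, y) ↦ g(y)` is integrable on the product; then Fubini). -/
theorem integrable_parametric {F : T3 × Quad → ℝ} {g : Quad → ℝ} (hF : Measurable F) (hg : Integrable g)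
    (hb : ∀ p, ‖F p‖ ≤ g p.2) : Integrable fun x : T3 => ∫ y, F (x, y) := by
  have hI : Integrable F ((volume : Measure T3).prod (volume : Measure Quad)) :=
    (hg.comp_snd (volume : Measure T3)).mono' hF.stronglyMeasurable.aestronglyMeasurable (Eventually.of_forall hb)
  exact hI.integral_prod_left

/-- A bounded Borel factor times an integrable function is integrable on the torus. -/
theorem integrable_bdd_mul {f g : T3 → ℝ} (hg : Integrable g) (hf : Measurable f) {c : ℝ} (hb : ∀ x, ‖f x‖ ≤ c) :
    Integrable fun x => f x * g x :=
  hg.bdd_mul hf.aestronglyMeasurable (Eventually.of_forall hb)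

end DVAggregate

/-! ## Registered anchor of this support file -/

/-- ANCHOR (registered helper stub `bhDVAggregate_measurable_anchor` of the crux item): for a continuous kernel
`ψ_N`, the integrand `e^{ΔΛ/2} · chaosDens` of the smeared cross-Hellinger mass is jointly Borel in
(location, quadruple). -/
theorem bhDVAggregate_measurable_anchor : ∀ (N : ℕ) (ψ : ℕ → T3 → ℝ) (h δ : ℝ) (w : Cfg N), Continuous (ψ N) → Measurable fun p : T3 × Quad => Real.exp (2⁻¹ * dLam N ψ h δ w p.1 p.2) * chaosDens N ψ h w p.1 p.2 :=
  fun _ _ h δ w hψc => DVAggregate.measurable_tiltIntegrand hψc h δ w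

end

end Summit.AtomisticToContinuum.HydrodynamicLimit.Theorems.BlockHDissipation
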